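import Literature.AlgebraicGeometry.HodgeTheory.AbelianVarietyPullbackQuadratic
import Literature.AlgebraicGeometry.HodgeTheory.WeilClassesSquareRationalBasis
import Literature.AlgebraicGeometry.HodgeTheory.HodgeRiemannDegreeOne
import HarnessLib

/-!
# The twisted square with a `K`-SYMMETRIC polarization: `E_± = ℂ·(d·ω ± i√d·ω_φ)^{⌣g}` (the packet's `P1` / `Ps` classes)

Family `hodge`, layer `Literature/AlgebraicGeometry/HodgeTheory`. Sequel of `WeilClassesSquareDivisorPolynomial(Squares)`,
`WeilClassesSquareRationalBasis` and `AbelianVarietyPullbackQuadratic`. There the Weil lines of the twisted square `(T × T, φ × (-φ))`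
(`φ ≫ φ = -d`) are `E_c = ℂ · Ω_c(θ)^{⌣g}` with `Ω_c = R + c·S`, `R = ψ^*θ - d·m^*θ`, `S = (ψ + m)^*θ - ψ^*θ - m^*θ` (`m = p₁ + p₂`,
`ψ = p₁ ≫ φ - p₂ ≫ φ`), for ANY `θ ∈ H²(T)` with `θ^{⌣g} ≠ 0`. Here `θ` is moreover `K`-SYMMETRIC, `φ^*θ = d·θ` (a polarization whose
Rosati involution induces complex conjugation on `K = ℚ(√-d)`: Deligne LNM 900 (4.4), van Geemen 5.2; at the B2b ladder's CM anchor
`Y = E_K³(ι) × E_K³(ῑ)` the product principal polarization `θ = Σ_t [o]_t`, `LADDER.md ## CARVER v7` C50), and the generator COLLAPSES to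

  `ω := m^*θ - p₁^*θ - p₂^*θ`  (`sqMixedClass`; at `θ = Σ_t [o]_t`: `Σ_t P1_t`, `P1_t = [Γ_1^{t,t+3}] - u_t - u_{t+3}`),
  `ω_φ := (p₁ + p₂ ≫ φ)^*θ - p₁^*θ - (p₂ ≫ φ)^*θ`  (`sqGraphMixedClass`; `(p₂ ≫ φ)^*θ = d·p₂^*θ` here; at `θ = Σ_t [o]_t`: `Σ_t Ps_t`,
  `Ps_t = [Γ_{√-d}^{t,t+3}] - d·u_t - u_{t+3}`):

* `twistedSquare_R_eq`: `R = -2d·ω`;  `cross_graph_swap_of_KSymmetric`: `ω'_φ = -ω_φ` (graph of `φ` in the two orders);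
  `twistedSquare_S_eq`: `S = -2·ω_φ`;  hence `weilGenerator ψ m d c θ = -2·(d·ω + c·ω_φ)` (`weilGenerator_twistedSquare_eq_of_KSymmetric`);
* **`weilClassesPlus (T × T) (φ × (-φ)) g d = ℂ · (d·ω + i√d·ω_φ)^{⌣g}`**, **`weilClassesMinus … = ℂ · (d·ω - i√d·ω_φ)^{⌣g}`**
  (`weilClassesPlus/Minus_twistedSquare_eq_span_of_KSymmetric`) for every `T` (dim `g ≥ 1`) and every `K`-symmetric `θ` with `θ^g ≠ 0`;
* SIXFOLDS (`weilClassesOf_twistedSquare_three_eq_span_of_KSymmetric`): with `R̃ = d·ω`, `S̃ = ω_φ`, **`W_K ⊗ ℂ = span_ℂ {X̃, Ỹ}`**,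
  `X̃ = R̃R̃R̃ - d(R̃S̃S̃ + S̃R̃S̃ + S̃S̃R̃)`, `Ỹ = (R̃R̃S̃ + R̃S̃R̃ + S̃R̃R̃) - d·S̃S̃S̃`. Dictionary with the carver's C36 (i) (`LADDER.md`):
  `d·ω + μ·ω_φ = μ·(ω_φ - μ·ω)` (`μ² = -d`), so `ℂ·(d·ω ± i√d·ω_φ)^{⌣g} = ℂ·(ω_φ ∓ i√d·ω)^{⌣g}`; at `θ = Σ_t [o]_t` the block terms
  `Ps_t ∓ √-d·P1_t` are decomposable (square to zero), so `(Σ_t (Ps_t ∓ √-d·P1_t))^{⌣3} = 6·∏_t (Ps_t ∓ √-d·P1_t)`: the carver's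
  `w_σ = -∏_t (Ps_t + √-d·P1_t)` is the generator of ONE of the two lines of this file, up to a unit and the sign conventions of the
  dictionary `ω ↔ Σ_t P1_t`, `ω_φ ↔ Σ_t Ps_t` (orientation of the graphs) — C36 (i) is now a tree theorem for every `T`.

Everything is PROVED; no named fact; the two definitions are abbreviations of explicit classes; not a rung.

## References

* [Deligne1982HodgeCycles] P. Deligne, LNM 900 (1982), (4.4), §4 Lemma 4.5 and Remark 4.10.
* [vanGeemen1994HodgeAV] B. van Geemen, LNM 1594 (1994), 4.9, Lemma 5.2 (2)–(3) and its proof, 5.3–5.4.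
* [LangeBirkenhake1992] H. Lange, Ch. Birkenhake, Complex Abelian Varieties (1992), 1.1.2, Lemma 1.1.17.
* [Hatcher2002] A. Hatcher, Algebraic Topology (2002), §3.2.
-/

noncomputable section

open CategoryTheory

namespace Literature.AlgebraicGeometry.HodgeTheory

open Literature.AlgebraicTopology.SingularHomology
open Literature.AlgebraicGeometry.Motives

section HodgeTheory

variable {A T : Motives.AbelianVariety ℂ} {d : ℕ} {φ : T ⟶ T}

/-! ### §3 The collapse at the twisted square: `R = -2d·ω`, `ω'_φ = -ω_φ`, `S = -2·ω_φ` -/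

/-- **`R = ψ^*θ - d·m^*θ = -2d·ω`** at the twisted square (`ψ = p₁ ≫ φ - p₂ ≫ φ`, `m = p₁ + p₂`,
`ω = m^*θ - p₁^*θ - p₂^*θ`) for `φ^*θ = d·θ`. [folklore] -/
theorem twistedSquare_R_eq {θ : complexBetti T.X 2} (hθ : complexBetti.map φ.hom.hom.hom 2 θ = (d : ℂ) • θ) :
    complexBetti.map (AbelianVariety.fst T T ≫ φ - AbelianVariety.snd T T ≫ φ).hom.hom.hom 2 θ -
        (d : ℂ) • complexBetti.map (AbelianVariety.fst T T + AbelianVariety.snd T T).hom.hom.hom 2 θ =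
      -(((2 : ℂ) * d) • (complexBetti.map (AbelianVariety.fst T T + AbelianVariety.snd T T).hom.hom.hom 2 θ -
        complexBetti.map (AbelianVariety.fst T T).hom.hom.hom 2 θ - complexBetti.map (AbelianVariety.snd T T).hom.hom.hom 2 θ)) := by
  set p₁ := AbelianVariety.fst T T
  set p₂ := AbelianVariety.snd T T
  have e1 : complexBetti.map (p₁ ≫ φ).hom.hom.hom 2 θ = (d : ℂ) • complexBetti.map p₁.hom.hom.hom 2 θ := by
    rw [← complexBetti_map_map_hom, hθ, map_smul]
  have e2 : complexBetti.map (p₂ ≫ φ).hom.hom.hom 2 θ = (d : ℂ) • complexBetti.map p₂.hom.hom.hom 2 θ := by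
    rw [← complexBetti_map_map_hom, hθ, map_smul]
  have h1 := cross_neg_left (p₂ ≫ φ) (p₁ ≫ φ) θ
  rw [map_neg_two, neg_add_eq_sub, add_comm (p₂ ≫ φ) (p₁ ≫ φ), e1, e2] at h1
  have h2 := cross_comp_right p₁ p₂ φ θ
  rw [hθ, map_smul, map_smul, map_smul, e1, e2] at h2
  rw [sub_sub, sub_eq_iff_eq_add] at h1 h2
  rw [h1, h2]
  module

/-- The morphism identity `(p₁ + p₂) ≫ (𝟙 + φ) = p₁ + p₁ ≫ φ + (p₂ + p₂ ≫ φ)`. [folklore] -/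
theorem add_comp_one_add (p₁ p₂ : A ⟶ T) (φ : T ⟶ T) :
    (p₁ + p₂) ≫ (𝟙 T + φ) = p₁ + p₁ ≫ φ + (p₂ + p₂ ≫ φ) := by
  rw [Preadditive.add_comp, Preadditive.comp_add, Preadditive.comp_add, Category.comp_id, Category.comp_id]

/-- **`B(p, p ≫ φ)θ = 0`** for `K`-symmetric `θ`: the mixed class of `p` and `p ≫ φ` is `p^*(B(𝟙,φ)θ) = 0`. [folklore] -/
theorem cross_self_comp_eq_zero_of_KSymmetric (hd : 0 < d) (hφ : φ ≫ φ = -(d • 𝟙 T)) {θ : complexBetti T.X 2}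
    (hθ : complexBetti.map φ.hom.hom.hom 2 θ = (d : ℂ) • θ) (p : A ⟶ T) :
    complexBetti.map (p + p ≫ φ).hom.hom.hom 2 θ - complexBetti.map p.hom.hom.hom 2 θ - complexBetti.map (p ≫ φ).hom.hom.hom 2 θ = 0 := by
  have h := cross_comp_left p (𝟙 T) φ θ
  rw [Category.comp_id] at h
  rw [h, abelianVariety_map_id_apply, cross_id_eq_zero_of_KSymmetric hd hφ hθ, map_zero]

/-- **`ω'_φ = -ω_φ`**: for `K`-symmetric `θ` the mixed classes of the graph of `φ` in the two orders are opposite,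
`B(p₁ ≫ φ, p₂)θ = -B(p₁, p₂ ≫ φ)θ` (expand `B` of `(p₁+p₂) ≫ (𝟙+φ)` bilinearly and use `(𝟙+φ)^*θ = (1+d)θ`, `B(pᵢ, pᵢ ≫ φ)θ = 0`,
`B(p₁ ≫ φ, p₂ ≫ φ)θ = d·ω`). [cite: vanGeemen1994HodgeAV, proof of Lemma 5.2] -/
theorem cross_graph_swap_of_KSymmetric (hd : 0 < d) (hφ : φ ≫ φ = -(d • 𝟙 T)) {θ : complexBetti T.X 2}
    (hθ : complexBetti.map φ.hom.hom.hom 2 θ = (d : ℂ) • θ) :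
    complexBetti.map (AbelianVariety.fst T T ≫ φ + AbelianVariety.snd T T).hom.hom.hom 2 θ -
        complexBetti.map (AbelianVariety.fst T T ≫ φ).hom.hom.hom 2 θ - complexBetti.map (AbelianVariety.snd T T).hom.hom.hom 2 θ =
      -(complexBetti.map (AbelianVariety.fst T T + AbelianVariety.snd T T ≫ φ).hom.hom.hom 2 θ -
        complexBetti.map (AbelianVariety.fst T T).hom.hom.hom 2 θ - complexBetti.map (AbelianVariety.snd T T ≫ φ).hom.hom.hom 2 θ) := by
  set p₁ := AbelianVariety.fst T T
  set p₂ := AbelianVariety.snd T T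
  have e1 : complexBetti.map (p₁ ≫ φ).hom.hom.hom 2 θ = (d : ℂ) • complexBetti.map p₁.hom.hom.hom 2 θ := by
    rw [← complexBetti_map_map_hom, hθ, map_smul]
  have e2 : complexBetti.map (p₂ ≫ φ).hom.hom.hom 2 θ = (d : ℂ) • complexBetti.map p₂.hom.hom.hom 2 θ := by
    rw [← complexBetti_map_map_hom, hθ, map_smul]
  -- (r1) `Big = (1+d)·W₀`
  have r1 : complexBetti.map (p₁ + p₁ ≫ φ + (p₂ + p₂ ≫ φ)).hom.hom.hom 2 θ =
      (1 + (d : ℂ)) • complexBetti.map (p₁ + p₂).hom.hom.hom 2 θ := by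
    rw [← add_comp_one_add, ← complexBetti_map_map_hom, map_one_add_two_of_KSymmetric hd hφ hθ, map_smul]
  -- (r2) the pieces of the bilinear expansion
  have hab := cross_self_comp_eq_zero_of_KSymmetric hd hφ hθ p₁
  have hce := cross_self_comp_eq_zero_of_KSymmetric hd hφ hθ p₂
  have hsplit := cross_add_left p₁ (p₁ ≫ φ) (p₂ + p₂ ≫ φ) θ
  have hA := cross_add_left p₂ (p₂ ≫ φ) p₁ θ
  have hB := cross_add_left p₂ (p₂ ≫ φ) (p₁ ≫ φ) θ
  have hC := cross_comp_right p₁ p₂ φ θ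
  rw [hθ, map_smul, map_smul, map_smul] at hC
  -- normalise the morphism sums so that the atoms match
  have s1 : p₂ + p₂ ≫ φ + p₁ = p₁ + (p₂ + p₂ ≫ φ) := by abel
  have s2 : p₂ + p₁ = p₁ + p₂ := by abel
  have s3 : p₂ ≫ φ + p₁ = p₁ + p₂ ≫ φ := by abel
  have s4 : p₂ + p₂ ≫ φ + p₁ ≫ φ = p₁ ≫ φ + (p₂ + p₂ ≫ φ) := by abel
  have s5 : p₂ + p₁ ≫ φ = p₁ ≫ φ + p₂ := by abel
  have s6 : p₂ ≫ φ + p₁ ≫ φ = p₁ ≫ φ + p₂ ≫ φ := by abel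
  rw [s1, s2, s3] at hA
  rw [s4, s5, s6] at hB
  linear_combination (norm := module) -hsplit - hA - hB - hC + r1 - hab - hce - e1 - e2

/-- **`S = (ψ + m)^*θ - ψ^*θ - m^*θ = -2·ω_φ`** at the twisted square for `K`-symmetric `θ`, where
`ω_φ = B(p₁, p₂ ≫ φ)θ = (p₁ + p₂ ≫ φ)^*θ - p₁^*θ - (p₂ ≫ φ)^*θ` is the mixed class of the graph of `φ`
(bilinear expansion of `B(p₁ ≫ φ - p₂ ≫ φ, p₁ + p₂)`, the vanishing `B(pᵢ, pᵢ ≫ φ)θ = 0` and the swap `ω'_φ = -ω_φ`).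
[cite: vanGeemen1994HodgeAV, proof of Lemma 5.2] -/
theorem twistedSquare_S_eq (hd : 0 < d) (hφ : φ ≫ φ = -(d • 𝟙 T)) {θ : complexBetti T.X 2}
    (hθ : complexBetti.map φ.hom.hom.hom 2 θ = (d : ℂ) • θ) :
    complexBetti.map (AbelianVariety.fst T T ≫ φ - AbelianVariety.snd T T ≫ φ +
          (AbelianVariety.fst T T + AbelianVariety.snd T T)).hom.hom.hom 2 θ -
        complexBetti.map (AbelianVariety.fst T T ≫ φ - AbelianVariety.snd T T ≫ φ).hom.hom.hom 2 θ -
        complexBetti.map (AbelianVariety.fst T T + AbelianVariety.snd T T).hom.hom.hom 2 θ =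
      -((2 : ℂ) • (complexBetti.map (AbelianVariety.fst T T + AbelianVariety.snd T T ≫ φ).hom.hom.hom 2 θ -
        complexBetti.map (AbelianVariety.fst T T).hom.hom.hom 2 θ -
        complexBetti.map (AbelianVariety.snd T T ≫ φ).hom.hom.hom 2 θ)) := by
  set p₁ := AbelianVariety.fst T T
  set p₂ := AbelianVariety.snd T T
  have hS0 := cross_add_left (p₁ ≫ φ) (-(p₂ ≫ φ)) (p₁ + p₂) θ
  rw [← sub_eq_add_neg] at hS0
  have hneg := cross_neg_left (p₂ ≫ φ) (p₁ + p₂) θ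
  rw [map_neg_two] at hneg hS0
  have hX := cross_add_left p₁ p₂ (p₁ ≫ φ) θ
  have hY := cross_add_left p₁ p₂ (p₂ ≫ φ) θ
  have t1 : p₁ + p₂ + p₁ ≫ φ = p₁ ≫ φ + (p₁ + p₂) := by abel
  have t2 : p₁ + p₂ + p₂ ≫ φ = p₂ ≫ φ + (p₁ + p₂) := by abel
  have t3 : p₂ + p₁ ≫ φ = p₁ ≫ φ + p₂ := by abel
  rw [t1, t3] at hX
  rw [t2] at hY
  have hab := cross_self_comp_eq_zero_of_KSymmetric hd hφ hθ p₁
  have hce := cross_self_comp_eq_zero_of_KSymmetric hd hφ hθ p₂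
  have hswap := cross_graph_swap_of_KSymmetric hd hφ hθ
  have e2 : complexBetti.map (p₂ ≫ φ).hom.hom.hom 2 θ = (d : ℂ) • complexBetti.map p₂.hom.hom.hom 2 θ := by
    rw [← complexBetti_map_map_hom, hθ, map_smul]
  linear_combination (norm := module) hS0 + hX + hneg - hY + hab - hce + hswap

/-! ### §4 The Weil lines of the twisted square with a `K`-symmetric class -/

/-- **The mixed class `ω(θ) = m^*θ - p₁^*θ - p₂^*θ ∈ H²(T × T)`** of a class `θ ∈ H²(T)` (`m = p₁ + p₂`): the Künneth cross
term of `m^*θ` ("Poincaré class" of `θ`; for `T = E`, `θ = [o]`: `[Γ_1] - [o × E] - [E × o]`, the B2b packet's `P1`).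
[cite: LangeBirkenhake1992, 1.1.2 and Lemma 1.1.17] -/
def sqMixedClass (T : Motives.AbelianVariety ℂ) (θ : complexBetti T.X 2) : complexBetti (T.prod T).X 2 :=
  complexBetti.map (AbelianVariety.fst T T + AbelianVariety.snd T T).hom.hom.hom 2 θ -
    complexBetti.map (AbelianVariety.fst T T).hom.hom.hom 2 θ - complexBetti.map (AbelianVariety.snd T T).hom.hom.hom 2 θ

/-- **The graph mixed class `ω_φ(θ) = (p₁ + p₂ ≫ φ)^*θ - p₁^*θ - (p₂ ≫ φ)^*θ ∈ H²(T × T)`**: the Künneth cross term of the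
pull-back of `θ` along `(x, y) ↦ x + φ(y)` (for `T = E`, `θ = [o]`, `φ = √-d`: `[Γ_{√-d}] - d·[o × E] - [E × o]`, the packet's `Ps`;
for `K`-symmetric `θ`, `(p₂ ≫ φ)^*θ = d·p₂^*θ`). [cite: LangeBirkenhake1992, 1.1.2 and Lemma 1.1.17] -/
def sqGraphMixedClass (φ : T ⟶ T) (θ : complexBetti T.X 2) : complexBetti (T.prod T).X 2 :=
  complexBetti.map (AbelianVariety.fst T T + AbelianVariety.snd T T ≫ φ).hom.hom.hom 2 θ -
    complexBetti.map (AbelianVariety.fst T T).hom.hom.hom 2 θ - complexBetti.map (AbelianVariety.snd T T ≫ φ).hom.hom.hom 2 θ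

/-- For `K`-symmetric `θ` (`φ^*θ = dθ`): `ω_φ(θ) = (p₁ + p₂ ≫ φ)^*θ - p₁^*θ - d·p₂^*θ` — the carver's normalisation
`Ps = [Γ_{√-d}] - d·u - u'`. [cite: vanGeemen1994HodgeAV, Lemma 5.2] -/
theorem sqGraphMixedClass_eq_of_KSymmetric {θ : complexBetti T.X 2} (hθ : complexBetti.map φ.hom.hom.hom 2 θ = (d : ℂ) • θ) :
    sqGraphMixedClass φ θ = complexBetti.map (AbelianVariety.fst T T + AbelianVariety.snd T T ≫ φ).hom.hom.hom 2 θ -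
      complexBetti.map (AbelianVariety.fst T T).hom.hom.hom 2 θ - (d : ℂ) • complexBetti.map (AbelianVariety.snd T T).hom.hom.hom 2 θ := by
  rw [sqGraphMixedClass, ← complexBetti_map_map_hom, hθ, map_smul]

/-- **Collapse of the generator: `Ω_c(θ) = -2·(d·ω + c·ω_φ)`** at the twisted square for `K`-symmetric `θ`
(`weilGenerator (p₁ ≫ φ - p₂ ≫ φ) (p₁ + p₂) d c θ`, from `R = -2d·ω` and `S = -2·ω_φ`). [cite: Deligne1982HodgeCycles, §4 Remark 4.10]
[cite: vanGeemen1994HodgeAV, proof of Lemma 5.2] -/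
theorem weilGenerator_twistedSquare_eq_of_KSymmetric (hd : 0 < d) (hφ : φ ≫ φ = -(d • 𝟙 T)) {θ : complexBetti T.X 2}
    (hθ : complexBetti.map φ.hom.hom.hom 2 θ = (d : ℂ) • θ) (c : ℂ) :
    weilGenerator (AbelianVariety.fst T T ≫ φ - AbelianVariety.snd T T ≫ φ) (AbelianVariety.fst T T + AbelianVariety.snd T T) d c θ =
      -((2 : ℂ) • ((d : ℂ) • sqMixedClass T θ + c • sqGraphMixedClass φ θ)) := by
  rw [weilGenerator, twistedSquare_S_eq hd hφ hθ, twistedSquare_R_eq hθ, sqMixedClass, sqGraphMixedClass]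
  module

/-- **`E₊ = ℂ · (d·ω + i√d·ω_φ)^{⌣g}`** for the twisted square `(T × T, φ × (-φ))`, `dim T = g ≥ 1`, `φ ≫ φ = -d`, `d ≥ 1`, and every
`K`-SYMMETRIC `θ ∈ H²(T)` (`φ^*θ = dθ`) with `θ^{⌣g} ≠ 0` — the B2b packet's "`w ∝ (Ps + √-d·P1)^g`" at the CM square, for every `T`.
[cite: Deligne1982HodgeCycles, §4 Remark 4.10] [cite: vanGeemen1994HodgeAV, 4.9 and proof of Lemma 5.2] -/
theorem weilClassesPlus_twistedSquare_eq_span_of_KSymmetric {g : ℕ} (hg : 0 < g) (hT : T.dim = g) (hd : 0 < d)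
    (hφ : φ ≫ φ = -(d • 𝟙 T)) {θ : complexBetti T.X 2} (hθ : complexBetti.map φ.hom.hom.hom 2 θ = (d : ℂ) • θ)
    (hθg : cupPowTwo θ g ≠ 0) :
    weilClassesPlus (T.prod T)
        (AbelianVariety.prodLift (AbelianVariety.fst T T ≫ φ) (AbelianVariety.snd T T ≫ (-φ))) g d =
      ℂ ∙ cupPowTwo ((d : ℂ) • sqMixedClass T θ + (Complex.I * (Real.sqrt d : ℂ)) • sqGraphMixedClass φ θ) g := by
  rw [weilClassesPlus_twistedSquare_eq_span hg hT hd hφ hθg, weilGenerator_twistedSquare_eq_of_KSymmetric hd hφ hθ,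
    ← neg_smul, cupPowTwo_smul]
  exact Submodule.span_singleton_smul_eq (isUnit_iff_ne_zero.2 (pow_ne_zero _ (neg_ne_zero.2 two_ne_zero))) _

/-- **`E₋ = ℂ · (d·ω - i√d·ω_φ)^{⌣g}`** (same hypotheses). [cite: Deligne1982HodgeCycles, §4 Remark 4.10]
[cite: vanGeemen1994HodgeAV, 4.9 and proof of Lemma 5.2] -/
theorem weilClassesMinus_twistedSquare_eq_span_of_KSymmetric {g : ℕ} (hg : 0 < g) (hT : T.dim = g) (hd : 0 < d)
    (hφ : φ ≫ φ = -(d • 𝟙 T)) {θ : complexBetti T.X 2} (hθ : complexBetti.map φ.hom.hom.hom 2 θ = (d : ℂ) • θ)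
    (hθg : cupPowTwo θ g ≠ 0) :
    weilClassesMinus (T.prod T)
        (AbelianVariety.prodLift (AbelianVariety.fst T T ≫ φ) (AbelianVariety.snd T T ≫ (-φ))) g d =
      ℂ ∙ cupPowTwo ((d : ℂ) • sqMixedClass T θ - (Complex.I * (Real.sqrt d : ℂ)) • sqGraphMixedClass φ θ) g := by
  rw [weilClassesMinus_twistedSquare_eq_span hg hT hd hφ hθg, weilGenerator_twistedSquare_eq_of_KSymmetric hd hφ hθ,
    ← neg_smul, cupPowTwo_smul, neg_smul, ← sub_eq_add_neg]
  exact Submodule.span_singleton_smul_eq (isUnit_iff_ne_zero.2 (pow_ne_zero _ (neg_ne_zero.2 two_ne_zero))) _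

/-- **Sixfolds: `W_K ⊗ ℂ = span_ℂ {X̃, Ỹ}` with `R̃ = d·ω`, `S̃ = ω_φ`** — for the twisted square of an abelian THREEFOLD `T` with
`φ ≫ φ = -d` and a `K`-symmetric `θ` with `θ³ ≠ 0` (e.g. the CM square `E_K³(ι) × E_K³(ῑ)` with its product principal polarization, the
anchor of the ladder's door C∘S): `X̃ = R̃R̃R̃ - d(R̃S̃S̃ + S̃R̃S̃ + S̃S̃R̃)`, `Ỹ = (R̃R̃S̃ + R̃S̃R̃ + S̃R̃R̃) - d·S̃S̃S̃` (products `cupThree`, nested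
as `cupPowTwo`; rational when `θ` is). [cite: Deligne1982HodgeCycles, §4 Remark 4.10] [cite: vanGeemen1994HodgeAV, 4.9] -/
theorem weilClassesOf_twistedSquare_three_eq_span_of_KSymmetric (hT : T.dim = 3) (hd : 0 < d)
    (hφ : φ ≫ φ = -(d • 𝟙 T)) {θ : complexBetti T.X 2} (hθ : complexBetti.map φ.hom.hom.hom 2 θ = (d : ℂ) • θ)
    (hθg : cupPowTwo θ 3 ≠ 0) :
    weilClassesOf (T.prod T)
        (AbelianVariety.prodLift (AbelianVariety.fst T T ≫ φ) (AbelianVariety.snd T T ≫ (-φ))) 3 d =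
      Submodule.span ℂ
        {cupThree ((d : ℂ) • sqMixedClass T θ) ((d : ℂ) • sqMixedClass T θ) ((d : ℂ) • sqMixedClass T θ) -
            (d : ℂ) • (cupThree ((d : ℂ) • sqMixedClass T θ) (sqGraphMixedClass φ θ) (sqGraphMixedClass φ θ) +
              cupThree (sqGraphMixedClass φ θ) ((d : ℂ) • sqMixedClass T θ) (sqGraphMixedClass φ θ) +
              cupThree (sqGraphMixedClass φ θ) (sqGraphMixedClass φ θ) ((d : ℂ) • sqMixedClass T θ)),
          (cupThree ((d : ℂ) • sqMixedClass T θ) ((d : ℂ) • sqMixedClass T θ) (sqGraphMixedClass φ θ) +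
              cupThree ((d : ℂ) • sqMixedClass T θ) (sqGraphMixedClass φ θ) ((d : ℂ) • sqMixedClass T θ) +
              cupThree (sqGraphMixedClass φ θ) ((d : ℂ) • sqMixedClass T θ) ((d : ℂ) • sqMixedClass T θ)) -
            (d : ℂ) • cupThree (sqGraphMixedClass φ θ) (sqGraphMixedClass φ θ) (sqGraphMixedClass φ θ)} := by
  set R := (d : ℂ) • sqMixedClass T θ
  set S := sqGraphMixedClass φ θ
  set μ : ℂ := Complex.I * (Real.sqrt d : ℂ) with hμdef
  have hμ : μ * μ = -(d : ℂ) := by rw [hμdef, ← pow_two, I_mul_sqrt_sq]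
  have hμ3 : μ * μ * μ = -(d : ℂ) * μ := by rw [hμ]
  have hP := weilClassesPlus_twistedSquare_eq_span_of_KSymmetric (by norm_num) hT hd hφ hθ hθg
  have hM := weilClassesMinus_twistedSquare_eq_span_of_KSymmetric (by norm_num) hT hd hφ hθ hθg
  rw [weilClassesOf, hP, hM, ← hμdef]
  have eP : cupPowTwo (R + μ • S) 3 =
      (cupThree R R R - (d : ℂ) • (cupThree R S S + cupThree S R S + cupThree S S R)) +
        μ • ((cupThree R R S + cupThree R S R + cupThree S R R) - (d : ℂ) • cupThree S S S) := by
    rw [cupPowTwo_add_smul_three, hμ3, hμ]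
    module
  have eM : cupPowTwo (R - μ • S) 3 =
      (cupThree R R R - (d : ℂ) • (cupThree R S S + cupThree S R S + cupThree S S R)) +
        (-μ) • ((cupThree R R S + cupThree R S R + cupThree S R R) - (d : ℂ) • cupThree S S S) := by
    have hμ' : (-μ) * (-μ) = -(d : ℂ) := by rw [neg_mul_neg, hμ]
    have hμ3' : (-μ) * (-μ) * (-μ) = -(d : ℂ) * (-μ) := by rw [hμ']
    rw [sub_eq_add_neg, ← neg_smul, cupPowTwo_add_smul_three, hμ3', hμ']
    module
  rw [eP, eM, ← Submodule.span_insert, span_pair_add_smul_sub_smul _ _ (I_mul_sqrt_ne_zero hd)]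

/-- **Eightfolds: `W_K ⊗ ℂ = span_ℂ {X̃₄, Ỹ₄}` with `R̃ = d·ω`, `S̃ = ω_φ`** — for the twisted square of an abelian FOURFOLD `T` with
`φ ≫ φ = -d` and a `K`-symmetric `θ` with `θ⁴ ≠ 0` (e.g. the CM square `E_K⁴(ι) × E_K⁴(ῑ)`, a hyperbolic eightfold: the anchor dimension
of the ladder's door A∘S(4,d)): `X̃₄ = R̃R̃R̃R̃ - d·Σ_{|S|=2} + d²·S̃S̃S̃S̃`, `Ỹ₄ = Σ_{|S|=1} - d·Σ_{|S|=3}` (products `cupFour`, nested as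
`cupPowTwo`; rational when `θ` is). [cite: Deligne1982HodgeCycles, §4 Remark 4.10] [cite: vanGeemen1994HodgeAV, 4.9] -/
theorem weilClassesOf_twistedSquare_four_eq_span_of_KSymmetric (hT : T.dim = 4) (hd : 0 < d)
    (hφ : φ ≫ φ = -(d • 𝟙 T)) {θ : complexBetti T.X 2} (hθ : complexBetti.map φ.hom.hom.hom 2 θ = (d : ℂ) • θ)
    (hθg : cupPowTwo θ 4 ≠ 0) :
    weilClassesOf (T.prod T)
        (AbelianVariety.prodLift (AbelianVariety.fst T T ≫ φ) (AbelianVariety.snd T T ≫ (-φ))) 4 d =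
      Submodule.span ℂ
        {cupFour ((d : ℂ) • sqMixedClass T θ) ((d : ℂ) • sqMixedClass T θ) ((d : ℂ) • sqMixedClass T θ) ((d : ℂ) • sqMixedClass T θ) -
            (d : ℂ) • (cupFour ((d : ℂ) • sqMixedClass T θ) ((d : ℂ) • sqMixedClass T θ) (sqGraphMixedClass φ θ) (sqGraphMixedClass φ θ) +
              cupFour ((d : ℂ) • sqMixedClass T θ) (sqGraphMixedClass φ θ) ((d : ℂ) • sqMixedClass T θ) (sqGraphMixedClass φ θ) +
              cupFour ((d : ℂ) • sqMixedClass T θ) (sqGraphMixedClass φ θ) (sqGraphMixedClass φ θ) ((d : ℂ) • sqMixedClass T θ) +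
              cupFour (sqGraphMixedClass φ θ) ((d : ℂ) • sqMixedClass T θ) ((d : ℂ) • sqMixedClass T θ) (sqGraphMixedClass φ θ) +
              cupFour (sqGraphMixedClass φ θ) ((d : ℂ) • sqMixedClass T θ) (sqGraphMixedClass φ θ) ((d : ℂ) • sqMixedClass T θ) +
              cupFour (sqGraphMixedClass φ θ) (sqGraphMixedClass φ θ) ((d : ℂ) • sqMixedClass T θ) ((d : ℂ) • sqMixedClass T θ)) +
            ((d : ℂ) * d) • cupFour (sqGraphMixedClass φ θ) (sqGraphMixedClass φ θ) (sqGraphMixedClass φ θ) (sqGraphMixedClass φ θ),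
          (cupFour ((d : ℂ) • sqMixedClass T θ) ((d : ℂ) • sqMixedClass T θ) ((d : ℂ) • sqMixedClass T θ) (sqGraphMixedClass φ θ) +
              cupFour ((d : ℂ) • sqMixedClass T θ) ((d : ℂ) • sqMixedClass T θ) (sqGraphMixedClass φ θ) ((d : ℂ) • sqMixedClass T θ) +
              cupFour ((d : ℂ) • sqMixedClass T θ) (sqGraphMixedClass φ θ) ((d : ℂ) • sqMixedClass T θ) ((d : ℂ) • sqMixedClass T θ) +
              cupFour (sqGraphMixedClass φ θ) ((d : ℂ) • sqMixedClass T θ) ((d : ℂ) • sqMixedClass T θ) ((d : ℂ) • sqMixedClass T θ)) -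
            (d : ℂ) • (cupFour ((d : ℂ) • sqMixedClass T θ) (sqGraphMixedClass φ θ) (sqGraphMixedClass φ θ) (sqGraphMixedClass φ θ) +
              cupFour (sqGraphMixedClass φ θ) ((d : ℂ) • sqMixedClass T θ) (sqGraphMixedClass φ θ) (sqGraphMixedClass φ θ) +
              cupFour (sqGraphMixedClass φ θ) (sqGraphMixedClass φ θ) ((d : ℂ) • sqMixedClass T θ) (sqGraphMixedClass φ θ) +
              cupFour (sqGraphMixedClass φ θ) (sqGraphMixedClass φ θ) (sqGraphMixedClass φ θ) ((d : ℂ) • sqMixedClass T θ))} := by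
  set R := (d : ℂ) • sqMixedClass T θ
  set S := sqGraphMixedClass φ θ
  set μ : ℂ := Complex.I * (Real.sqrt d : ℂ) with hμdef
  have hμ : μ * μ = -(d : ℂ) := by rw [hμdef, ← pow_two, I_mul_sqrt_sq]
  have hμ3 : μ * μ * μ = -(d : ℂ) * μ := by rw [hμ]
  have hμ4 : μ * μ * μ * μ = (d : ℂ) * d := by rw [hμ, mul_assoc, hμ, neg_mul_neg]
  have hP := weilClassesPlus_twistedSquare_eq_span_of_KSymmetric (by norm_num) hT hd hφ hθ hθg
  have hM := weilClassesMinus_twistedSquare_eq_span_of_KSymmetric (by norm_num) hT hd hφ hθ hθg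
  rw [weilClassesOf, hP, hM, ← hμdef]
  have eP : cupPowTwo (R + μ • S) 4 =
      (cupFour R R R R - (d : ℂ) • (cupFour R R S S + cupFour R S R S + cupFour R S S R + cupFour S R R S + cupFour S R S R +
          cupFour S S R R) + ((d : ℂ) * d) • cupFour S S S S) +
        μ • ((cupFour R R R S + cupFour R R S R + cupFour R S R R + cupFour S R R R) -
          (d : ℂ) • (cupFour R S S S + cupFour S R S S + cupFour S S R S + cupFour S S S R)) := by
    rw [cupPowTwo_add_smul_four, hμ4, hμ3, hμ]
    module
  have eM : cupPowTwo (R - μ • S) 4 =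
      (cupFour R R R R - (d : ℂ) • (cupFour R R S S + cupFour R S R S + cupFour R S S R + cupFour S R R S + cupFour S R S R +
          cupFour S S R R) + ((d : ℂ) * d) • cupFour S S S S) +
        (-μ) • ((cupFour R R R S + cupFour R R S R + cupFour R S R R + cupFour S R R R) -
          (d : ℂ) • (cupFour R S S S + cupFour S R S S + cupFour S S R S + cupFour S S S R)) := by
    have hμ' : (-μ) * (-μ) = -(d : ℂ) := by rw [neg_mul_neg, hμ]
    have hμ3' : (-μ) * (-μ) * (-μ) = -(d : ℂ) * (-μ) := by rw [hμ']
    have hμ4' : (-μ) * (-μ) * (-μ) * (-μ) = (d : ℂ) * d := by rw [hμ', mul_assoc, hμ', neg_mul_neg]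
    rw [sub_eq_add_neg, ← neg_smul, cupPowTwo_add_smul_four, hμ4', hμ3', hμ']
    module
  rw [eP, eM, ← Submodule.span_insert, span_pair_add_smul_sub_smul _ _ (I_mul_sqrt_ne_zero hd)]

end HodgeTheory

end Literature.AlgebraicGeometry.HodgeTheory

end
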